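import Literature.MathematicalPhysics.QuantumFieldTheory.Balaban1983to89.T3AlphaInputsAC
import HarnessLib

/-!
# `Balaban1983to89.T3AlphaInputsACSchemas` — the (α) socket `defn-AlphaInputsT3AC`, part 2: the PACKAGE PREDICATE `AlphaInputsT3AC`
# (the item's notion: the conjunction of the v1 schemas the route owner's `stub_alphaOfLane` delivers for a constructed `AlphaDataT3`), and
# the owner's three «S5-readiness» schemas (ADDENDUM to OWNER RULING g15-№1 (2), 2026-08-26): the history functional of (41) OPENED as a
# finite sum over region histories of large-field fibre integrals (`LFData`, `LFSum`), the χ-support link (`NoTrivOnLarge`), and the small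
# factors (70)–(71) of the large-field plaquettes (`SmallFactor71`) — hypothesis schemas over exposed data, never asserted

Continues `T3AlphaInputsAC` (p452599): same conventions — run-`K` level currency, `W : GaugeField (F.P K) j SU(2)`, nothing asserted, no
instance, no notation; every `def … : Prop` is a predicate ON EXPOSED DATA.  Director-ym LINE №17 (a); second-reader remark of record (typer g40,
2026-08-26T14:22Z): in (41) p.266 the exponent sits INSIDE the conditional integrals «∫dV_{k−1}↾_{Z_{k−1}} δ(V̄_{k−1}V^{−1}) ⋯ ∫dV₀↾_{Z₀} δ(V̄₀V₁^{−1})»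
and depends on the integration variables through (42) («U: Ū_j = V_j on Λ_j … V_k = V»), so a history CARRIES its large-field variables: the
finite object is the set of REGION histories `{Ω_i, Z_i}` ((38)–(40): finitely many on a finite torus), and `LF` is a finite sum over them of
integrals over the large-field fibres — still linear in `exp ∘ Φ`, so the decoupling of crux 18916 S5 can be argued region-history by
region-history.  The fibre of run `K` below level `j` is carried as FULL fields `(i : Fin j) → GaugeField (F.P K) i SU(2)` under the product Haar
measure (the weight ignores the bond variables off `Z_i`; Haar is normalised, so the extra integrations change nothing).

* §1 `AlphaInputsT3AC D b₀ p₀ ε₀ C68` — THE PACKAGE (v1.1 erratum form): `PintDecomp ∧ IsLocal ∧ GaugeInv26 ∧ (∃ C κ₁, TermSize) ∧ SizesR ∧ ChiRange ∧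
  (∀ j ≤ K, Ineq41AE ∧ Ineq47AE ∧ EnvelopeRegular) ∧ RepAtHeights ∧ Constraint42Top ∧ MainTermIsAction ∧ Regularity68 ∧ AdmOnSmall ∧ ∃EnlBounded ∧
  UminTrivIsRegMinimiser ∧ ∃LocCover` + named projections (v1's form used `Sizes` — print's `e^{−E}` normalisation, not the route's — and the
  pointwise `Ineq41At/Ineq47At`, underivable for a Radon–Nikodym version: both corrected here, §7 of `T3AlphaInputsAC`).
* §2 `LFData D` (region histories `Reg` (finite), `trivReg`, the assembling map `assemble : Reg × fibre → Hist`, the weight `wt ≥ 0`, the large-field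
  plaquette sets `LargeP`), `LFSum` ((41): `LF W Φ = Σ_r ∫ wt(r,v,W)·exp Φ(assemble r v) dv`; under it `LFShape`'s shift is the THEOREM
  `lf_shift_of_LFSum` and its monotonicity the theorem `lf_mono_of_LFSum` modulo fibrewise integrability), `LargePSpec` ((67): large plaquettes lie in `Λ_i` and are
  datum-large), `NoTrivOnLarge` ((40)/(47): a datum-large plaquette kills `χ` and the trivial history's weight), `blockAround` (print's `Δ′`, the four
  `i`-blocks at the corners of a level-`i` plaquette) and `SmallFactor71` ((70)–(71): the action of the composite minimiser localised to `Δ′(p′)` is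
  `≥ ¼p(g_i)²` in units of `β_K`, for every large plaquette `p′` of the history); `AlphaInputsT3ACFull` = the package ∧ these four (one name for
  crux 18916's v5 common pair).

References: T. Bałaban, CMP 102 (1985) 255–275 [Balaban1985UV3] ((38)–(43) p.266, (47) p.267, (67)–(71) pp.273–274); T. Bałaban, CMP 98 (1985)
17–51 [Balaban1985Averaging] (Lemma 1 p.25).
-/

noncomputable section

open MeasureTheory
open Literature.MathematicalPhysics.QuantumFieldTheory.Balaban1983to89.T3ContinuumYM3Torus
open Literature.MathematicalPhysics.QuantumFieldTheory.Balaban1983to89.T3UnitLawDensityEML (ℰp)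
open Literature.MathematicalPhysics.QuantumFieldTheory.Balaban1983to89.T3UnitScaleTilt
open Literature.MathematicalPhysics.QuantumFieldTheory.Balaban1983to89.T3RestrictedUnitDensity
open Literature.MathematicalPhysics.QuantumFieldTheory.Balaban1983to89.T3AlphaInputsAC
open Literature.MathematicalPhysics.QuantumFieldTheory.Balaban1983to89.B10Eq38TorusDomains (toFine cornerSet plaqsIn)
open Literature.MathematicalPhysics.QuantumFieldTheory.Balaban1983to89.B3Ineq314Cubes (cubeIdx)

namespace Literature.MathematicalPhysics.QuantumFieldTheory.Balaban1983to89.T3AlphaInputsACSchemas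

/-! ## §1 The package predicate (the item's notion) -/

section Package

variable {F : T3Family} {γ : ℝ}

/-- **BAŁABAN'S (α) INPUT PACKAGE READ AT THE T3 OBJECTS** (hypothesis schema on a GIVEN datum `D`, never asserted; the notion of ledger item
`defn-AlphaInputsT3AC`; v1.1 ERRATUM form): the conjunction of the printed clauses of `T3AlphaInputsAC` for `D` — the locality of the interaction
terms ((43), p.263, (26), (44)), the ROUTE-NORMALISED sizes `SizesR` ((41) last term, (46), (62)/(65) — v1 bundled `Sizes`, whose `EcstSize` encodes
print's `e^{−E}` start (1) p.256 and is not satisfiable for the route's `resDensity`: erratum), the characteristic function's range, the two-sided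
inductive inequalities (41)/(47) for the route's `ℰp` densities at every level `j ≤ K` in their deliverable A.E. form (`Ineq41AE`/`Ineq47AE`,
pub-balaban3d finding F-α1-2) with integrable envelopes, the same at the UV-small-history height densities through the 19201 socket, the
constraint (42)/(67), the main term as `β_K·A(U_k)`, the regularity (68), and the four ANTI-JUNK clauses of §6 (`AdmOnSmall`, `EnlBounded`,
`UminTrivIsRegMinimiser`, `LocCover` — ★ym-ust-19201-p2's finding 0364c67c41f82510: without them a junk datum `Adm := ∅, enl := univ,
Pterm := (log ρ + bg)∘avg^j, Rm := 0` satisfies the rest).  This is what the route owner's `stub_alphaOfLane` delivers WITH a constructed `D`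
(existence is never part of this predicate); Theorem 2 p.272 («The sequence of densities ρ_k defined by the inductive equations (2), with ρ₀
given by (1), satisfies the inequalities (41), (47)») is its printed source for Bałaban's own averaging.
[cite: Balaban1985UV3, Thm 2 p.272, (41) p.266 and (47) p.267] -/
def AlphaInputsT3AC (D : AlphaDataT3 F γ) (b₀ p₀ ε₀ C68 : ℝ) : Prop :=
  (PintDecomp D ∧ IsLocal D ∧ GaugeInv26 D ∧ ∃ C κ₁ : ℝ, TermSize D b₀ p₀ C κ₁) ∧
    SizesR D b₀ p₀ ∧ ChiRange D ∧
      (∀ K j, j ≤ K → Ineq41AE D K j ∧ Ineq47AE D K j ∧ EnvelopeRegular D K j) ∧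
        RepAtHeights D b₀ p₀ ε₀ ∧ (Constraint42Top D ∧ MainTermIsAction D ∧ Regularity68 D b₀ p₀ C68) ∧
          (AdmOnSmall D b₀ p₀ ∧ (∃ (M₁ : ℕ) (r : ℝ), EnlBounded D M₁ r) ∧ UminTrivIsRegMinimiser D b₀ p₀ ε₀ ∧
            ∃ κ₁ C : ℝ, LocCover D κ₁ C)

namespace AlphaInputsT3AC

variable {D : AlphaDataT3 F γ} {b₀ p₀ ε₀ C68 : ℝ} (h : AlphaInputsT3AC D b₀ p₀ ε₀ C68)
include h

/-- The package gives (41′) a.e. at every level. [cite: Balaban1985UV3, (41) p.266] -/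
theorem ineq41AE {K j : ℕ} (hj : j ≤ K) : Ineq41AE D K j := (h.2.2.2.1 K j hj).1

/-- The package gives (47′) a.e. at every level. [cite: Balaban1985UV3, (47) p.267] -/
theorem ineq47AE {K j : ℕ} (hj : j ≤ K) : Ineq47AE D K j := (h.2.2.2.1 K j hj).2.1

/-- The package gives the regularity of the envelopes at every level. [cite: Balaban1985UV3, (47) p.267] -/
theorem envelopeRegular {K j : ℕ} (hj : j ≤ K) : EnvelopeRegular D K j := (h.2.2.2.1 K j hj).2.2

/-- The package gives the 19201 reading. [cite: Balaban1985UV3, (41) p.266 and (47) p.267] -/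
theorem repAtHeights : RepAtHeights D b₀ p₀ ε₀ := h.2.2.2.2.1

/-- The package gives the locality of the interaction terms. [cite: Balaban1985UV3, p.263 after (26)] -/
theorem isLocal : IsLocal D := h.1.2.1

/-- The package gives the route-normalised sizes. [cite: Balaban1985UV3, (46) p.267 and (65) p.273] -/
theorem sizesR : SizesR D b₀ p₀ := h.2.1

/-- The package gives contract B6: `e^{2Rm_j}` bounded uniformly in the cut-off. [cite: Balaban1985UV3, (41) p.266] -/
theorem exp_two_Rm_le : ∃ CRm : ℝ, ∀ K j, j ≤ K → Real.exp (2 * D.Rm K j) ≤ CRm := h.2.1.exp_two_Rm_le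

/-- The package gives print's regularity (68). [cite: Balaban1985UV3, (68) p.273] -/
theorem regularity68 : Regularity68 D b₀ p₀ C68 := h.2.2.2.2.2.1.2.2

/-- The package gives the admissibility of the small window at the trivial history (anti-junk). [cite: Balaban1985UV3, (47) p.267] -/
theorem admOnSmall : AdmOnSmall D b₀ p₀ := h.2.2.2.2.2.2.1

/-- The package pins the trivial-history minimiser to print's regular minimiser (anti-junk). [cite: Balaban1985Variational, Thm 1 (8) p.279] -/
theorem uminTrivIsRegMinimiser : UminTrivIsRegMinimiser D b₀ p₀ ε₀ := h.2.2.2.2.2.2.2.2.1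

/-- The package gives `0 ≤ low`. [cite: Balaban1985UV3, (47) p.267] -/
theorem low_nonneg (K j : ℕ) (W : GaugeField (F.P K) j (Matrix.specialUnitaryGroup (Fin 2) ℂ)) : 0 ≤ D.low K j W :=
  T3AlphaInputsAC.low_nonneg h.2.2.1 K j W

/-- The package gives `0 ≤ up` almost everywhere. [cite: Balaban1985UV3, (41) p.266 and (47) p.267] -/
theorem up_nonneg_ae {K j : ℕ} (hj : j ≤ K) :
    ∀ᵐ W ∂fieldMeasure (F.P K) j (Matrix.specialUnitaryGroup (Fin 2) ℂ), 0 ≤ D.up K j W :=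
  T3AlphaInputsAC.up_nonneg_ae h.2.2.1 (h.ineq41AE hj) (h.ineq47AE hj)

end AlphaInputsT3AC

end Package

/-! ## §2 The history functional opened: region histories × large-field fibres; the χ-support link; the small factors (70)–(71) -/

section Histories

variable {F : T3Family} {γ : ℝ}

/-- **THE HISTORY FUNCTIONAL OF (41), OPENED** (data signature; nothing asserted): `Reg K j` = the REGION histories `({Ω_i}_{i≤j}, {Z_i}_{i<j})`
of run `K` below level `j` ((38)–(40) p.266 — finitely many on a finite torus, `regFintype`), `trivReg` the trivial one; `assemble K j r v` assembles a
history of `D` from a region history `r` and the LARGE-FIELD VARIABLES `v = (V_i)_{i<j}` (carried as full fields of the levels `i < j`; the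
weight ignores them off `Z_i`); `wt K j r v W ≥ 0` = the product of the characteristic functions «χ_k ζ_{Λ_{k−1}} χ_{k−1} ⋯ ζ_{Λ₁} χ₁ ζ_{Ω₁^c}» and
the δ-kernel factors of (41) at `(r, v, W)`; `LargeP K j r i` = the large-field plaquettes of level `i` of the history ((7)–(8) p.257, (67) p.273).
[cite: Balaban1985UV3, (38)-(41) p.266] -/
structure LFData (D : AlphaDataT3 F γ) where
  /-- The region histories `{Ω_i, Z_i}` of run `K` below level `j`. -/
  Reg : ℕ → ℕ → Type
  /-- There are finitely many region histories. -/
  regFintype : ∀ K j, Fintype (Reg K j)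
  /-- The trivial region history (all `Ω_i = T_η`, all `Z_i = ∅`). -/
  trivReg : (K j : ℕ) → Reg K j
  /-- Assembling a history from its regions and its large-field variables. -/
  assemble : (K j : ℕ) → Reg K j → ((i : Fin j) → GaugeField (F.P K) i (Matrix.specialUnitaryGroup (Fin 2) ℂ)) → D.Hist K j
  /-- The non-negative history weight of (41) (characteristic functions and δ-kernel factors). -/
  wt : (K j : ℕ) → Reg K j → ((i : Fin j) → GaugeField (F.P K) i (Matrix.specialUnitaryGroup (Fin 2) ℂ)) →
    GaugeField (F.P K) j (Matrix.specialUnitaryGroup (Fin 2) ℂ) → ℝ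
  /-- The large-field plaquettes of level `i` of a region history. -/
  LargeP : (K j : ℕ) → Reg K j → (i : ℕ) → Finset (Plaq (F.P K) i)

/-- **(41) AS A FINITE SUM OF FIBRE INTEGRALS** (hypothesis schema on the exposed data, never asserted; owner ADDENDUM (i)): the weight is
non-negative, the trivial region history with any fibre value IS the trivial history of `D`, and for every exponent `Φ`,
`LF_j(W)[Φ] = Σ_{r} ∫ wt(r, v, W)·exp Φ(assemble r v) dv`, `dv` the product Haar measure of the levels `i < j` — (41) p.266 «Σ_{{Ω_j}} ∫dV_{k−1}↾_{Z_{k−1}}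
δ(V̄_{k−1}V^{−1}) ⋯ ∫dV₀↾_{Z₀} δ(V̄₀V₁^{−1}) χ_k ζ_{Λ_{k−1}} χ_{k−1} ⋯ ζ_{Λ₁} χ₁ ζ_{Ω₁^c} exp[⋯]». [cite: Balaban1985UV3, (41) p.266] -/
def LFSum (D : AlphaDataT3 F γ) (W : LFData D) : Prop :=
  (∀ K j (r : W.Reg K j) v Wf, 0 ≤ W.wt K j r v Wf) ∧
    (∀ K j v, W.assemble K j (W.trivReg K j) v = D.triv K j) ∧
      ∀ K j (Wf : GaugeField (F.P K) j (Matrix.specialUnitaryGroup (Fin 2) ℂ)) (Φ : D.Hist K j → ℝ),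
        D.LF K j Wf Φ =
          (letI := W.regFintype K j
           ∑ r : W.Reg K j, ∫ v, W.wt K j r v Wf * Real.exp (Φ (W.assemble K j r v))
              ∂Measure.pi fun i : Fin j => fieldMeasure (F.P K) (i : ℕ) (Matrix.specialUnitaryGroup (Fin 2) ℂ))

/-- Under `LFSum` the history functional is multiplicative on constants — the `lf_shift` half of `LFShape` becomes a theorem:
`LF_j(W)[Φ + t] = eᵗ·LF_j(W)[Φ]`. [cite: Balaban1985UV3, (41) p.266] -/
theorem lf_shift_of_LFSum {D : AlphaDataT3 F γ} {W : LFData D} (h : LFSum D W) (K j : ℕ)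
    (Wf : GaugeField (F.P K) j (Matrix.specialUnitaryGroup (Fin 2) ℂ)) (Φ : D.Hist K j → ℝ) (t : ℝ) :
    D.LF K j Wf (fun h' => Φ h' + t) = Real.exp t * D.LF K j Wf Φ := by
  rw [h.2.2 K j Wf, h.2.2 K j Wf]
  letI := W.regFintype K j
  rw [Finset.mul_sum]
  refine Finset.sum_congr rfl fun r _ => ?_
  rw [← integral_const_mul]
  refine integral_congr_ae (ae_of_all _ fun v => ?_)
  simp only [Real.exp_add]
  ring

/-- Under `LFSum` the history functional is monotone in the exponent whenever the larger integrand is integrable fibrewise — the `lf_mono`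
half of `LFShape` modulo integrability (`wt ≥ 0`, `exp` monotone). [cite: Balaban1985UV3, (41) p.266] -/
theorem lf_mono_of_LFSum {D : AlphaDataT3 F γ} {W : LFData D} (h : LFSum D W) (K j : ℕ)
    (Wf : GaugeField (F.P K) j (Matrix.specialUnitaryGroup (Fin 2) ℂ)) {Φ Ψ : D.Hist K j → ℝ} (hle : ∀ h', Φ h' ≤ Ψ h')
    (hint : ∀ r : W.Reg K j, Integrable (fun v => W.wt K j r v Wf * Real.exp (Ψ (W.assemble K j r v)))
      (Measure.pi fun i : Fin j => fieldMeasure (F.P K) (i : ℕ) (Matrix.specialUnitaryGroup (Fin 2) ℂ))) :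
    D.LF K j Wf Φ ≤ D.LF K j Wf Ψ := by
  rw [h.2.2 K j Wf, h.2.2 K j Wf]
  letI := W.regFintype K j
  refine Finset.sum_le_sum fun r _ => ?_
  refine integral_mono_of_nonneg (ae_of_all _ fun v => ?_) (hint r) (ae_of_all _ fun v => ?_)
  · exact mul_nonneg (h.1 K j r v Wf) (Real.exp_nonneg _)
  · exact mul_le_mul_of_nonneg_left (Real.exp_le_exp.mpr (hle _)) (h.1 K j r v Wf)

/-- **THE LARGE-FIELD PLAQUETTES OF A HISTORY LIE IN ITS REGIONS `Λ_i` AND ARE DATUM-LARGE** (hypothesis schema, never asserted): (67) p.273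
«Let us take a plaquette p′ ⊂ Λ_j and such that |V_j(∂p′) − 1| ≥ g_jp(g_j)», with «Ū_k^j = V_j on Λ_j» — the level-`i` average of the composite
minimiser is the history's level-`i` field there. [cite: Balaban1985UV3, (67) p.273] -/
def LargePSpec (D : AlphaDataT3 F γ) (W : LFData D) (b₀ p₀ : ℝ) : Prop :=
  ∀ K j (r : W.Reg K j) v Wf i (p' : Plaq (F.P K) i), j ≤ K → p' ∈ W.LargeP K j r i →
    i < j ∧ p' ∈ plaqsIn i (D.Λ K j (W.assemble K j r v) i) ∧
      θBal F.L γ b₀ p₀ (K - i) ≤ GaugeGroup.dist1 (GaugeField.plaqHol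
        (Averaging.iter (fun l => BlockAveraging.blockAvg (P := F.P K) (j := l) ℰp) i (D.Umin K j (W.assemble K j r v) Wf)) p')

/-- **A DATUM-LARGE PLAQUETTE KILLS THE TRIVIAL-HISTORY TERMS** (hypothesis schema, never asserted; owner ADDENDUM (ii), the χ-support link):
if the level-`j` datum `W` has a plaquette with `|W(∂p) − 1| ≥ Cχ·g_jp(g_j)` then `χ_j(W) = 0` ((47) p.267 «χ_k corresponds to the restrictions
on V given by the conditions |U_k(∂p) − 1| < g_kp(g_k)η², p ⊂ T_η», read on the datum through the averaging bound [Balaban1985Averaging]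
Lemma 1 — the constant `Cχ` is exposed), and if `|W(∂p) − 1| ≥ 2L²B₃·g_{j−1}p(g_{j−1})` then the trivial history's weight vanishes ((40) p.266
«χ_j = Π_{p⊂Ω_j} χ({|V_{j−1}(∂p) − 1| < 2L²B₃g_{j−1}p(g_{j−1})})» with `Ω_j = T_η`, `V_k = V`). [cite: Balaban1985UV3, (40) p.266 and (47) p.267] -/
def NoTrivOnLarge (D : AlphaDataT3 F γ) (W : LFData D) (b₀ p₀ Cχ B₃ : ℝ) : Prop :=
  ∀ K j (Wf : GaugeField (F.P K) j (Matrix.specialUnitaryGroup (Fin 2) ℂ)) (p : Plaq (F.P K) j), j ≤ K →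
    (Cχ * θBal F.L γ b₀ p₀ (K - j) ≤ GaugeGroup.dist1 (GaugeField.plaqHol Wf p) → D.χ K j Wf = 0) ∧
      (2 * (F.L : ℝ) ^ 2 * B₃ * θBal F.L γ b₀ p₀ (K - j + 1) ≤ GaugeGroup.dist1 (GaugeField.plaqHol Wf p) →
        ∀ v, W.wt K j (W.trivReg K j) v Wf = 0)

/-- Under `LFSum` and `NoTrivOnLarge`, at a datum with a `2L²B₃θ`-large plaquette the trivial region history contributes nothing to `LF`
(its integrand vanishes identically). [cite: Balaban1985UV3, (40)-(41) p.266] -/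
theorem triv_integrand_eq_zero {D : AlphaDataT3 F γ} {W : LFData D} {b₀ p₀ Cχ B₃ : ℝ} (hN : NoTrivOnLarge D W b₀ p₀ Cχ B₃) {K j : ℕ} (hj : j ≤ K)
    {Wf : GaugeField (F.P K) j (Matrix.specialUnitaryGroup (Fin 2) ℂ)} {p : Plaq (F.P K) j}
    (hp : 2 * (F.L : ℝ) ^ 2 * B₃ * θBal F.L γ b₀ p₀ (K - j + 1) ≤ GaugeGroup.dist1 (GaugeField.plaqHol Wf p))
    (Φ : D.Hist K j → ℝ) (v : (i : Fin j) → GaugeField (F.P K) i (Matrix.specialUnitaryGroup (Fin 2) ℂ)) :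
    W.wt K j (W.trivReg K j) v Wf * Real.exp (Φ (W.assemble K j (W.trivReg K j) v)) = 0 := by
  rw [(hN K j Wf p hj).2 hp v, zero_mul]

/-- **PRINT'S `Δ′`**: the union of the level-`i` blocks of the fine torus at the four corners of a level-`i` plaquette `p′` ((70) p.273 «Δ′ =
B^j(x₀) ∪ B^j(y₀) ∪ B^j(z₀) ∪ B^j(w₀)», `p′ = ⟨x₀, y₀, z₀, w₀⟩`), blocks read by the tree's `cubeIdx`. [cite: Balaban1985UV3, (70) p.273] -/
def blockAround (K i : ℕ) (p : Plaq (F.P K) i) : Set (Site (F.P K) 0) :=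
  {y | ∃ x ∈ cornerSet i p, cubeIdx (F.L ^ i) y = cubeIdx (F.L ^ i) x}

/-- **THE SMALL FACTORS (70)–(71) OF THE LARGE-FIELD PLAQUETTES** (hypothesis schema, never asserted; owner ADDENDUM (iii)): for an admissible
pair and every large-field plaquette `p′` of level `i` of the history, the part of the main action localised to `Δ′(p′)` is at least
`¼p(g_i)²`: `β_K·Σ_{q ⊂ Δ′(p′)} [1 − Re tr U_j(h,W)(∂q)] ≥ ¼·p(g_i)²`, `g_i = √(γL^{−(K−i)})` — (70)–(71) pp.273–274 «Thus the part of the action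
(1/g_k²)A^η(U_k) localized to the sum of four j-blocks Δ′ connected with the plaquette p′ can be bounded from below by ¼p²(g_j), and the
corresponding part of the exponential gives the small factor exp(−¼p²(g_j)). We get these small factors for all plaquettes in all large fields
set P» (for `g_j` sufficiently small; the overlap bookkeeping of the `Δ′` is [9] §3.C, not this clause; tree: `B10.eq71_arith`,
`B10.LargeFieldControlPrinted`). [cite: Balaban1985UV3, (70)-(71) p.273] -/
def SmallFactor71 (D : AlphaDataT3 F γ) (W : LFData D) (b₀ p₀ : ℝ) : Prop :=
  ∀ K j (r : W.Reg K j) v Wf, j ≤ K → D.Adm K j (W.assemble K j r v) Wf → ∀ i (p' : Plaq (F.P K) i), p' ∈ W.LargeP K j r i →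
    (1 / 4 : ℝ) * B10.pFun b₀ p₀ (Real.sqrt (γ * ((F.L : ℝ)⁻¹) ^ (K - i))) ^ 2 ≤
      (F.scheme ℰp γ).β K *
        ∑ q ∈ plaqsIn 0 (blockAround K i p'), (1 - reTr (GaugeField.plaqHol (D.Umin K j (W.assemble K j r v) Wf) q))

/-- Under `MainTermIsAction`, the localised action of `SmallFactor71` is a part of the main term: `β_K·Σ_{q⊂Δ′}(1 − Re tr) ≤ mainT` (every
plaquette term is non-negative). [cite: Balaban1985UV3, (5) p.256 and (70) p.273] -/
theorem localised_le_mainT {D : AlphaDataT3 F γ} (hM : MainTermIsAction D) (hβ : ∀ K, 0 ≤ (F.scheme ℰp γ).β K) {K j : ℕ} (h : D.Hist K j)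
    (Wf : GaugeField (F.P K) j (Matrix.specialUnitaryGroup (Fin 2) ℂ)) (S : Finset (Plaq (F.P K) 0)) :
    (F.scheme ℰp γ).β K * ∑ q ∈ S, (1 - reTr (GaugeField.plaqHol (D.Umin K j h Wf) q)) ≤ D.mainT K j h Wf := by
  rw [hM K j h Wf]
  refine mul_le_mul_of_nonneg_left ?_ (hβ K)
  unfold wilsonAction4 wilsonAction
  simp only [one_mul]
  exact Finset.sum_le_sum_of_subset_of_nonneg (Finset.subset_univ S) fun q _ _ => by
    have := GaugeGroup.reTr_le_one (GaugeField.plaqHol (D.Umin K j h Wf) q)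
    linarith

/-- **THE FULL (α) PACKAGE FOR CRUX 18916's S5** (hypothesis schema on GIVEN data `D`, `W`, never asserted): the package `AlphaInputsT3AC`
together with the opened history functional and the large-field clauses — `LFSum ∧ LargePSpec ∧ NoTrivOnLarge ∧ SmallFactor71` (one name for
the owner's 18916 v5 common pair; existence of `D`, `W` is never part of it). [cite: Balaban1985UV3, Thm 2 p.272, (41) p.266 and (70)-(71) p.273] -/
def AlphaInputsT3ACFull (D : AlphaDataT3 F γ) (W : LFData D) (b₀ p₀ ε₀ C68 Cχ B₃ : ℝ) : Prop :=
  AlphaInputsT3AC D b₀ p₀ ε₀ C68 ∧ LFSum D W ∧ LargePSpec D W b₀ p₀ ∧ NoTrivOnLarge D W b₀ p₀ Cχ B₃ ∧ SmallFactor71 D W b₀ p₀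

/-- The full package contains the package. [cite: Balaban1985UV3, Thm 2 p.272] -/
theorem AlphaInputsT3ACFull.base {D : AlphaDataT3 F γ} {W : LFData D} {b₀ p₀ ε₀ C68 Cχ B₃ : ℝ}
    (h : AlphaInputsT3ACFull D W b₀ p₀ ε₀ C68 Cχ B₃) : AlphaInputsT3AC D b₀ p₀ ε₀ C68 := h.1

end Histories

end Literature.MathematicalPhysics.QuantumFieldTheory.Balaban1983to89.T3AlphaInputsACSchemas

end
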